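import Summits.MatrixMultiplication.MatrixMultiplication.Theorems.LieRankDesigns.Negative.BigCellSums

/-!
# Negative lemmas for the crux `LieRankDesigns` (stmt-MatrixMultiplication-7614), part S2:
a level-one ANNIHILATOR on the big cell of `SL_2(𝔽_p)` (`p ≥ 5`)

Continues part S1 (`BigCellSums`); no theorem here asserts a Theses statement positively, and no
definition is introduced.  The signed measure ("Bessel annihilator") on the big cell is
`K(g(l,b,c)) = ψ(−ac − db)·(ψ(−v₁/l) − ψ(−v₂/l))` with `a = d = 1` and `v₁ ≠ v₂` two residues missed by
the Kloosterman frequency map `μ ↦ μ − ad/μ`; it is written out where used.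

* `sum_ker_mul_psi_eq_zero` — `Σ_{l,b,c} K ψ(tr(M g(l,b,c))) = 0` for every `M` with `det M = 0`
  (part S1's `(b,c)`-sums, then `Σ_{l≠0} ψ(t/l) = −1` twice).
* `exists_two_nonvalues` — for `p ≥ 5`, `ad ≠ 0` the frequency map misses two distinct residues: it is
  constant on the pairs `{μ, −ad/μ}` (fixed points `μ² = −ad`, at most two), so its image has at most
  `(p+1)/2 < p − 1` elements.
* `stdAddChar_sub_ne_zero` — `ψ(−v₁) ≠ ψ(−v₂)` for `v₁ ≠ v₂`.
* `exists_bigCell_annihilator` — THE PACKAGE used by part S3: for `p ≥ 5` there is `W : M_2(𝔽_p) → ℂ`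
  with `W(1) ≠ 0`, supported on the big-cell matrices `g(l,b,c)`, `l ≠ 0`, and such that every two-sided
  translate `g ↦ W(e g f)` is orthogonal to every level-one test function `Σ_{rk M ≤ 1} c_M ψ(tr(M g))`.
-/

set_option linter.dupNamespace false

noncomputable section

namespace Summit.MatrixMultiplication.MatrixMultiplication.Theorems.LieRankDesigns.Negative

open Summit.MatrixMultiplication.MatrixMultiplication.Theses.LevelGradedCohnUmans
open Summit.MatrixMultiplication.MatrixMultiplication.Theorems.LevelOneGL2Designs.Negative

variable {p : ℕ} [Fact p.Prime]

/-! ## The kernel is orthogonal to every level-one mode -/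

/-- **Orthogonality of the kernel.**  For `a, d ≠ 0`, `v₁, v₂` non-values of `μ ↦ μ − ad/μ` on `𝔽_p^×`
and `det M = 0`: `Σ_{l,b,c} K(l,b,c)·ψ(tr(M g(l,b,c))) = 0`, where
`K(l,b,c) = [l ≠ 0]·ψ(−ac − db)·(ψ(−v₁/l) − ψ(−v₂/l))`. -/
theorem sum_ker_mul_psi_eq_zero {a d v₁ v₂ : ZMod p} (ha : a ≠ 0) (hd : d ≠ 0)
    (hv₁ : ∀ μ : ZMod p, μ ≠ 0 → μ - a * d * μ⁻¹ ≠ v₁)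
    (hv₂ : ∀ μ : ZMod p, μ ≠ 0 → μ - a * d * μ⁻¹ ≠ v₂) {M : Mat p 2} (hdet : M.det = 0) :
    ∑ l : ZMod p, ∑ b : ZMod p, ∑ c : ZMod p,
      (if l = 0 then (0 : ℂ) else
        ZMod.stdAddChar (-(a * c) - d * b) *
          (ZMod.stdAddChar (-(v₁ * l⁻¹)) - ZMod.stdAddChar (-(v₂ * l⁻¹)))) *
      ZMod.stdAddChar (Matrix.trace (M * !![l, l * b; c * l, c * l * b + l⁻¹])) = 0 := by
  classical
  -- pull the `l`-kernel out of the `(b,c)`-sum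
  have hl_term : ∀ l : ZMod p,
      ∑ b : ZMod p, ∑ c : ZMod p,
        (if l = 0 then (0 : ℂ) else
          ZMod.stdAddChar (-(a * c) - d * b) *
            (ZMod.stdAddChar (-(v₁ * l⁻¹)) - ZMod.stdAddChar (-(v₂ * l⁻¹)))) *
        ZMod.stdAddChar (Matrix.trace (M * !![l, l * b; c * l, c * l * b + l⁻¹]))
      = (if l = 0 then (0 : ℂ) else
          (ZMod.stdAddChar (-(v₁ * l⁻¹)) - ZMod.stdAddChar (-(v₂ * l⁻¹)))) *
        ∑ b : ZMod p, ∑ c : ZMod p, ZMod.stdAddChar (-(a * c) - d * b) *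
          ZMod.stdAddChar (Matrix.trace (M * !![l, l * b; c * l, c * l * b + l⁻¹])) := by
    intro l
    rw [Finset.mul_sum]
    refine Finset.sum_congr rfl fun b _ => ?_
    rw [Finset.mul_sum]
    refine Finset.sum_congr rfl fun c _ => ?_
    split_ifs <;> ring
  rw [Finset.sum_congr rfl (fun l _ => hl_term l)]
  by_cases h11 : M 1 1 = 0
  · refine Finset.sum_eq_zero fun l _ => ?_
    by_cases hl : l = 0
    · rw [if_pos hl, zero_mul]
    · rw [sum_bc_twist_eq_zero ha hd hdet h11, mul_zero]
  · -- the l-terms are (ψ(−v₁/l) − ψ(−v₂/l)) · p ψ(C) ψ(h/l) with t_i := h − v_i ≠ 0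
    set t₁ : ZMod p := M 1 1 - a * d * (M 1 1)⁻¹ - v₁ with ht₁
    set t₂ : ZMod p := M 1 1 - a * d * (M 1 1)⁻¹ - v₂ with ht₂
    have ht₁0 : t₁ ≠ 0 := fun h => hv₁ (M 1 1) h11 (by rw [ht₁] at h; exact sub_eq_zero.mp h)
    have ht₂0 : t₂ ≠ 0 := fun h => hv₂ (M 1 1) h11 (by rw [ht₂] at h; exact sub_eq_zero.mp h)
    set C : ℂ := (p : ℂ) * ZMod.stdAddChar ((a * M 1 0 + d * M 0 1) * (M 1 1)⁻¹) with hC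
    have hterm : ∀ l : ZMod p,
        (if l = 0 then (0 : ℂ) else
            (ZMod.stdAddChar (-(v₁ * l⁻¹)) - ZMod.stdAddChar (-(v₂ * l⁻¹)))) *
          ∑ b : ZMod p, ∑ c : ZMod p, ZMod.stdAddChar (-(a * c) - d * b) *
            ZMod.stdAddChar (Matrix.trace (M * !![l, l * b; c * l, c * l * b + l⁻¹]))
          = C * ((if l = 0 then (0 : ℂ) else ZMod.stdAddChar (t₁ * l⁻¹))
                  - (if l = 0 then (0 : ℂ) else ZMod.stdAddChar (t₂ * l⁻¹))) := by
      intro l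
      by_cases hl : l = 0
      · rw [if_pos hl, if_pos hl, if_pos hl, zero_mul, sub_self, mul_zero]
      · rw [if_neg hl, if_neg hl, if_neg hl, sum_bc_twist_eq hl hdet h11]
        have e₁ : ZMod.stdAddChar (N := p) (-(v₁ * l⁻¹)) *
            ZMod.stdAddChar ((M 1 1 - a * d * (M 1 1)⁻¹) * l⁻¹) = ZMod.stdAddChar (t₁ * l⁻¹) := by
          rw [← AddChar.map_add_eq_mul, ht₁]; congr 1; ring
        have e₂ : ZMod.stdAddChar (N := p) (-(v₂ * l⁻¹)) *
            ZMod.stdAddChar ((M 1 1 - a * d * (M 1 1)⁻¹) * l⁻¹) = ZMod.stdAddChar (t₂ * l⁻¹) := by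
          rw [← AddChar.map_add_eq_mul, ht₂]; congr 1; ring
        rw [← e₁, ← e₂, hC]
        ring
    rw [Finset.sum_congr rfl (fun l _ => hterm l), ← Finset.mul_sum, Finset.sum_sub_distrib,
      sum_psi_mul_inv ht₁0, sum_psi_mul_inv ht₂0, sub_self, mul_zero]

/-! ## Two non-values exist for `p ≥ 5` -/

/-- **Counting**: for `p ≥ 5` and `ad ≠ 0` the frequency map `μ ↦ μ − ad/μ` (`μ ≠ 0`) misses two distinct
residues.  It is constant on the pairs `{μ, −ad/μ}`, whose only degenerate members are the at most two roots
of `μ² = −ad`, so its image has at most `(p+1)/2` elements. -/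
theorem exists_two_nonvalues (hp : 5 ≤ p) {a d : ZMod p} (had : a * d ≠ 0) :
    ∃ v₁ v₂ : ZMod p, v₁ ≠ v₂ ∧ (∀ μ : ZMod p, μ ≠ 0 → μ - a * d * μ⁻¹ ≠ v₁) ∧
      (∀ μ : ZMod p, μ ≠ 0 → μ - a * d * μ⁻¹ ≠ v₂) := by
  classical
  set f : ZMod p → ZMod p := fun μ => μ - a * d * μ⁻¹ with hf
  -- the pairing μ ↦ −ad/μ preserves f
  have hpair : ∀ μ : ZMod p, f (-(a * d) * μ⁻¹) = f μ := by
    intro μ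
    simp only [hf, mul_inv, inv_inv]
    have h3 : (-(a * d))⁻¹ * (-(a * d)) = 1 := inv_mul_cancel₀ (neg_ne_zero.mpr had)
    linear_combination μ * h3
  -- domain s = 𝔽_p^×, split by the fixed points of the pairing (μ² = −ad)
  set s : Finset (ZMod p) := Finset.univ.filter (fun μ => μ ≠ 0) with hs
  set A : Finset (ZMod p) := s.filter (fun μ => μ * μ ≠ -(a * d)) with hA
  set B : Finset (ZMod p) := s.filter (fun μ => μ * μ = -(a * d)) with hB
  set t : Finset (ZMod p) := s.image f with ht
  have hcard_s : s.card = p - 1 := by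
    rw [hs, Finset.filter_ne' Finset.univ (0 : ZMod p), Finset.card_erase_of_mem (Finset.mem_univ _),
      Finset.card_univ, ZMod.card]
  have hsAB : s.card = A.card + B.card := by
    rw [hA, hB, add_comm]
    exact (Finset.card_filter_add_card_filter_not (s := s) (fun μ => μ * μ = -(a * d))).symm
  -- |B| ≤ 2
  have hB2 : B.card ≤ 2 := by
    by_cases hBe : B = ∅
    · rw [hBe]; simp
    · obtain ⟨μ₁, hμ₁⟩ := Finset.nonempty_of_ne_empty hBe
      have hμ₁' : μ₁ * μ₁ = -(a * d) := (Finset.mem_filter.1 hμ₁).2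
      have hsub : B ⊆ {μ₁, -μ₁} := by
        intro μ hμ
        have hμ' : μ * μ = -(a * d) := (Finset.mem_filter.1 hμ).2
        have h0 : (μ - μ₁) * (μ + μ₁) = 0 := by linear_combination hμ' - hμ₁'
        rcases mul_eq_zero.1 h0 with h | h
        · rw [sub_eq_zero] at h; simp [h]
        · rw [add_eq_zero_iff_eq_neg] at h; simp [h]
      exact (Finset.card_le_card hsub).trans (Finset.card_insert_le _ _)
  -- 2 |f(A)| ≤ |A| : fibres through A contain the pair {μ, −ad/μ}
  have hA2 : 2 * (A.image f).card ≤ A.card := by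
    refine Finset.mul_card_image_le_card A 2 fun v hv => ?_
    obtain ⟨μ, hμA, rfl⟩ := Finset.mem_image.1 hv
    have hμs : μ ∈ s := (Finset.mem_filter.1 hμA).1
    have hμ0 : μ ≠ 0 := (Finset.mem_filter.1 hμs).2
    have hμsq : μ * μ ≠ -(a * d) := (Finset.mem_filter.1 hμA).2
    set μ' : ZMod p := -(a * d) * μ⁻¹ with hμ'
    have hμ'0 : μ' ≠ 0 := mul_ne_zero (neg_ne_zero.mpr had) (inv_ne_zero hμ0)
    have h1 : μ * μ⁻¹ = 1 := mul_inv_cancel₀ hμ0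
    have hne : μ' ≠ μ := by
      intro h
      apply hμsq
      have : μ * μ = μ' * μ := by rw [h]
      rw [this, hμ']
      linear_combination -(a * d) * h1
    have hμ'sq : μ' * μ' ≠ -(a * d) := by
      intro h
      apply hμsq
      rw [hμ'] at h
      have h2 : a * d * (a * d + μ * μ) = 0 := by
        linear_combination (μ * μ) * h + (-(a * d) * (a * d) * μ⁻¹ * μ - (a * d) * (a * d)) * h1
      rcases mul_eq_zero.1 h2 with h3 | h3
      · exact absurd h3 had
      · linear_combination h3
    have hμ'A : μ' ∈ A := by
      rw [hA, Finset.mem_filter, hs, Finset.mem_filter]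
      exact ⟨⟨Finset.mem_univ _, hμ'0⟩, hμ'sq⟩
    have hpair_sub : ({μ, μ'} : Finset (ZMod p)) ⊆ A.filter (fun x => f x = f μ) := by
      intro x hx
      rw [Finset.mem_insert, Finset.mem_singleton] at hx
      rw [Finset.mem_filter]
      rcases hx with rfl | rfl
      · exact ⟨hμA, rfl⟩
      · exact ⟨hμ'A, hpair μ⟩
    calc 2 = ({μ, μ'} : Finset (ZMod p)).card := by rw [Finset.card_pair (Ne.symm hne)]
      _ ≤ _ := Finset.card_le_card hpair_sub
  -- |t| ≤ |f(A)| + |f(B)| ≤ |A|/2 + |B|, so 2|t| ≤ |A| + 2|B| ≤ p + 1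
  have ht_sub : t ⊆ A.image f ∪ B.image f := by
    intro v hv
    obtain ⟨μ, hμs, rfl⟩ := Finset.mem_image.1 hv
    rw [Finset.mem_union]
    by_cases h : μ * μ = -(a * d)
    · right; exact Finset.mem_image_of_mem _ (Finset.mem_filter.2 ⟨hμs, h⟩)
    · left; exact Finset.mem_image_of_mem _ (Finset.mem_filter.2 ⟨hμs, h⟩)
  have ht2 : 2 * t.card ≤ p + 1 := by
    have h1 : t.card ≤ (A.image f).card + (B.image f).card :=
      (Finset.card_le_card ht_sub).trans (Finset.card_union_le _ _)
    have h2 : (B.image f).card ≤ B.card := Finset.card_image_le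
    have h3 : 1 ≤ p := by omega
    omega
  -- hence the complement of t has ≥ 2 elements
  have hcompl : 1 < (Finset.univ \ t).card := by
    rw [Finset.card_sdiff_of_subset (Finset.subset_univ t), Finset.card_univ, ZMod.card]
    have : t.card ≤ p := by
      calc t.card ≤ (Finset.univ : Finset (ZMod p)).card := Finset.card_le_univ t
        _ = p := by rw [Finset.card_univ, ZMod.card]
    omega
  obtain ⟨v₁, hv₁, v₂, hv₂, hne⟩ := Finset.one_lt_card.1 hcompl
  rw [Finset.mem_sdiff] at hv₁ hv₂
  refine ⟨v₁, v₂, hne, fun μ hμ h => hv₁.2 ?_, fun μ hμ h => hv₂.2 ?_⟩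
  · exact Finset.mem_image.2 ⟨μ, Finset.mem_filter.2 ⟨Finset.mem_univ _, hμ⟩, h⟩
  · exact Finset.mem_image.2 ⟨μ, Finset.mem_filter.2 ⟨Finset.mem_univ _, hμ⟩, h⟩

/-- `ψ(−v₁) − ψ(−v₂) ≠ 0` for `v₁ ≠ v₂` (the standard character of `ZMod p` is injective). -/
theorem stdAddChar_sub_ne_zero {v₁ v₂ : ZMod p} (hne : v₁ ≠ v₂) :
    ZMod.stdAddChar (N := p) (-v₁) - ZMod.stdAddChar (N := p) (-v₂) ≠ 0 := by
  intro h
  rw [sub_eq_zero] at h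
  have h1 : ZMod.stdAddChar (N := p) (-v₁ + v₂) = 1 := by
    rw [AddChar.map_add_eq_mul, h, ← AddChar.map_add_eq_mul, neg_add_cancel, AddChar.map_zero_eq_one]
  have h2 := ((ZMod.isPrimitive_stdAddChar p).zmod_char_eq_one_iff p (-v₁ + v₂)).1 h1
  exact hne (neg_add_eq_zero.1 h2)

/-! ## The annihilator, packaged -/

/-- **THE BIG-CELL ANNIHILATOR** (`p ≥ 5`).  There is a function `W` on `M_2(𝔽_p)` with `W(1) ≠ 0`,
supported on the big-cell matrices `g(l,b,c) = [[l, l b], [c l, c l b + l⁻¹]]`, `l ≠ 0` (the big Bruhat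
cell of `SL_2(𝔽_p)`), all of whose two-sided translates `g ↦ W(e g f)` are orthogonal to every level-one
test function of `GL_2(𝔽_p)`.  (`W` = push-forward of `[l ≠ 0]·ψ(−c − b)·(ψ(−v₁/l) − ψ(−v₂/l))` with
`v₁ ≠ v₂` two non-values of `μ ↦ μ − 1/μ`.) -/
theorem exists_bigCell_annihilator (hp : 5 ≤ p) :
    ∃ W : Mat p 2 → ℂ, W 1 ≠ 0 ∧
      (∀ N : Mat p 2, W N ≠ 0 → ∃ l b c : ZMod p, l ≠ 0 ∧ N = !![l, l * b; c * l, c * l * b + l⁻¹]) ∧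
      (∀ co : Mat p 2 → ℂ, RankSupp 1 co → ∀ e f : GLm p 2,
        ∑ g : GLm p 2, W ((e * g * f : GLm p 2) : Mat p 2) * fourierFn co g = 0) := by
  classical
  obtain ⟨v₁, v₂, hne, hv₁, hv₂⟩ :=
    exists_two_nonvalues hp (a := 1) (d := 1) (by rw [mul_one]; exact one_ne_zero)
  -- the kernel and its push-forward
  set K : ZMod p → ZMod p → ZMod p → ℂ := fun l b c =>
    if l = 0 then (0 : ℂ) else
      ZMod.stdAddChar (-(1 * c) - 1 * b) *
        (ZMod.stdAddChar (-(v₁ * l⁻¹)) - ZMod.stdAddChar (-(v₂ * l⁻¹))) with hK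
  set W : Mat p 2 → ℂ := fun N => ∑ l : ZMod p, ∑ b : ZMod p, ∑ c : ZMod p,
    if (!![l, l * b; c * l, c * l * b + l⁻¹] : Mat p 2) = N then K l b c else 0 with hW
  -- support
  have hsupp : ∀ N : Mat p 2, W N ≠ 0 → ∃ l b c : ZMod p, l ≠ 0 ∧ N = !![l, l * b; c * l, c * l * b + l⁻¹] := by
    intro N h
    by_contra hne'
    push Not at hne'
    apply h
    refine Finset.sum_eq_zero fun l _ => Finset.sum_eq_zero fun b _ => Finset.sum_eq_zero fun c _ => ?_
    by_cases hl : l = 0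
    · simp [hK, hl]
    · rw [if_neg (fun h' => hne' l b c hl h'.symm)]
  -- pairing with a function of the matrix is the triple sum
  have hpairing : ∀ F : Mat p 2 → ℂ, ∑ N : Mat p 2, W N * F N
      = ∑ l : ZMod p, ∑ b : ZMod p, ∑ c : ZMod p, K l b c * F !![l, l * b; c * l, c * l * b + l⁻¹] := by
    intro F
    simp only [hW, Finset.sum_mul]
    rw [Finset.sum_comm]
    refine Finset.sum_congr rfl fun l _ => ?_
    rw [Finset.sum_comm]
    refine Finset.sum_congr rfl fun b _ => ?_
    rw [Finset.sum_comm]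
    refine Finset.sum_congr rfl fun c _ => ?_
    simp_rw [ite_mul, zero_mul]
    rw [Finset.sum_ite_eq]
    simp
  -- value at 1
  have hW1 : W 1 = ZMod.stdAddChar (-v₁) - ZMod.stdAddChar (-v₂) := by
    simp only [hW]
    rw [Finset.sum_eq_single (1 : ZMod p), Finset.sum_eq_single (0 : ZMod p),
      Finset.sum_eq_single (0 : ZMod p)]
    · rw [if_pos bigCell_one]; simp [hK]
    · intro c _ hc; rw [if_neg]; exact fun h => hc (bigCell_eq_one h).2.2
    · simp
    · intro b _ hb
      refine Finset.sum_eq_zero fun c _ => ?_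
      rw [if_neg]; exact fun h => hb (bigCell_eq_one h).2.1
    · simp
    · intro l _ hl
      refine Finset.sum_eq_zero fun b _ => Finset.sum_eq_zero fun c _ => ?_
      rw [if_neg]; exact fun h => hl (bigCell_eq_one h).1
    · simp
  -- untranslated orthogonality
  have horth : ∀ co : Mat p 2 → ℂ, RankSupp 1 co → ∑ g : GLm p 2, W (g : Mat p 2) * fourierFn co g = 0 := by
    intro co hco
    calc ∑ g : GLm p 2, W (g : Mat p 2) * fourierFn co g
        = ∑ g : GLm p 2, ∑ M : Mat p 2, co M *
            (W (g : Mat p 2) * ZMod.stdAddChar (Matrix.trace (M * (g : Mat p 2)))) := by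
          refine Finset.sum_congr rfl fun g _ => ?_
          rw [fourierFn, Finset.mul_sum]
          refine Finset.sum_congr rfl fun M _ => ?_
          ring
      _ = ∑ M : Mat p 2, co M * ∑ g : GLm p 2,
            W (g : Mat p 2) * ZMod.stdAddChar (Matrix.trace (M * (g : Mat p 2))) := by
          rw [Finset.sum_comm]
          refine Finset.sum_congr rfl fun M _ => ?_
          rw [Finset.mul_sum]
      _ = 0 := by
          refine Finset.sum_eq_zero fun M _ => ?_
          by_cases hcM : co M = 0
          · rw [hcM, zero_mul]
          · have hM : M.rank ≤ 1 := le_of_not_gt fun h => hcM (hco M h)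
            have hdet : M.det = 0 := (rank_le_one_iff_det_eq_zero M).1 hM
            have hzero : ∀ N : Mat p 2, ¬ IsUnit N →
                W N * ZMod.stdAddChar (Matrix.trace (M * N)) = 0 := by
              intro N hN
              by_cases hWN : W N = 0
              · rw [hWN, zero_mul]
              · obtain ⟨l, b, c, hl, rfl⟩ := hsupp N hWN
                exact absurd ((Matrix.isUnit_iff_isUnit_det _).2
                  (by rw [det_bigCell hl]; exact isUnit_one)) hN
            rw [sum_GL_eq_sum_mat (fun N => W N * ZMod.stdAddChar (Matrix.trace (M * N))) hzero,
              hpairing, sum_ker_mul_psi_eq_zero one_ne_zero one_ne_zero hv₁ hv₂ hdet, mul_zero]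
  refine ⟨W, by rw [hW1]; exact stdAddChar_sub_ne_zero hne, hsupp, fun co hco e f => ?_⟩
  -- translate
  have hre : ∑ g : GLm p 2, W ((e * g * f : GLm p 2) : Mat p 2) * fourierFn co g
      = ∑ h : GLm p 2, W (h : Mat p 2) * fourierFn co (e⁻¹ * h * f⁻¹) := by
    refine Fintype.sum_equiv ((Equiv.mulLeft e).trans (Equiv.mulRight f)) _ _ fun g => ?_
    simp only [Equiv.trans_apply, Equiv.coe_mulLeft, Equiv.coe_mulRight]
    congr 2
    group
  rw [hre]
  have h := horth (transl f⁻¹ e⁻¹ co) (rankSupp_transl _ _ hco)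
  simpa only [fourierFn_transl] using h

end Summit.MatrixMultiplication.MatrixMultiplication.Theorems.LieRankDesigns.Negative

end
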